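import Summits.ResolutionOfSingularities.ResolutionOfSingularities.Theses.IndSmooth
import Literature.AlgebraicGeometry.Resolution.ResolutionLU

/-!
# `IndSmooth.SmoothToUniformizing` is implied by the summit: anatomy of any refutation
# (negative-side support for crux `stmt-ResolutionOfSingularities-16088`, refuter / cdisprove seat)

Crux `Summit.ResolutionOfSingularities.ResolutionOfSingularities.Theses.IndSmooth.SmoothToUniformizing`
(the INJECTIVITY UPGRADE of route `IndSmooth`): for every prime `p`, ind-smoothness of every valuation
ring `O ⊇ k` of every finitely generated field `K` over every perfect field `k` of characteristic `p`
(every finitely generated `R ⊆ O` factors `R → T → O` through a smooth `k`-algebra `T`; = crux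
`ValuativeSmoothing` at `p`) implies relative local uniformization over perfect fields at `p`
(= target `LurelPerfect` at `p`: a finitely generated `A` with `R ≤ A ⊆ O`, `Frac A = K`, `A` regular at
the centre).

Findings (all sorry-free; nothing but theorems is declared under `Summits/`):

* `not_resolutionOfSingularities_of_not_smoothToUniformizing` — **a refutation of the crux refutes
  resolution of singularities in positive characteristic**: the consequent alone is implied by
  `ResolutionInChar p` (tree: `Literature.AlgebraicGeometry.Resolution.lurel_of_resolutionInChar`,
  i.e. `ResolutionInChar.relLocalUniformization` — the valuative criterion of properness applied to a
  resolution of `Spec` of an affine model — after enlarging `R` by an affine model of `K` inside `O`);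
  the ind-smoothness antecedent and perfectness of `k` are not used.
* `not_lurelPerfect_of_not_smoothToUniformizing` — likewise it refutes the route's own target.
* `exists_indSmooth_and_not_lurel_of_not_smoothToUniformizing` — **anatomy**: `¬ crux` is exactly a
  prime `p` together with (i) a PROOF of `ValuativeSmoothing` at `p` (ind-smoothness of ALL valuation
  rings of ALL function fields over ALL perfect fields of characteristic `p` — the printed open
  question, AntieauDatta2021 §4, Tang2024 p. 1) and (ii) a COUNTEREXAMPLE to relative local
  uniformization at `p`, hence to `ResolutionInChar p`. Every regime in which (i) is known
  (characteristic `0`, Abhyankar places, transcendence degree `≤ 3`, perfect `K`) is one in which (ii)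
  is known to be impossible. This is why the crux resists cheap refutation: it is an honest
  reduction step between two open problems, dominated by the summit.

Moral for provers: the crux carries no risk beyond the summit's; its content is entirely in HOW
ind-smoothness is converted into a regular model (see the crux work file
`Cruxes/SmoothToUniformizing/Disproof.lean` §2: with `Algebra.Smooth k T` deleted from the antecedent
the crux is `LurelPerfect` on the nose, so a proof must use the smooth structure of the charts).
-/

set_option linter.dupNamespace false -- mandated namespace of this single-conjunct summit

namespace Summit.ResolutionOfSingularities.ResolutionOfSingularities.Theorems.SmoothToUniformizing.Negative

open Summit.ResolutionOfSingularities.ResolutionOfSingularities.Theses.IndSmooth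
open Literature.AlgebraicGeometry.Resolution (ResolutionInChar lurel_of_resolutionInChar)

/-- **A refutation of `SmoothToUniformizing` refutes resolution of singularities in positive
characteristic**: the summit gives the consequent of the crux at every prime (tree:
`lurel_of_resolutionInChar`), the antecedent being unused. [folklore] -/
theorem not_resolutionOfSingularities_of_not_smoothToUniformizing (h : ¬ SmoothToUniformizing) :
    ¬ _root_.ResolutionOfSingularities :=
  fun H => h fun p hp _ k K _ _ _ _ _ => lurel_of_resolutionInChar p hp (H p hp) k K

/-- **A refutation of `SmoothToUniformizing` refutes the route's target `LurelPerfect`** (relative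
local uniformization over perfect fields): the target is the consequent, the antecedent is unused.
[folklore] -/
theorem not_lurelPerfect_of_not_smoothToUniformizing (h : ¬ SmoothToUniformizing) :
    ¬ LurelPerfect :=
  fun H => h fun p hp _ => H p hp

/-- **Anatomy of a refutation of `SmoothToUniformizing`**: it is a prime `p` at which
(i) `ValuativeSmoothing` HOLDS (every valuation ring of every function field over every perfect field
of characteristic `p` is ind-smooth — stated inline, verbatim the crux's antecedent),
(ii) relative local uniformization over perfect fields FAILS (inline, verbatim the crux's
consequent), and consequently (iii) `ResolutionInChar p` fails. [folklore] -/
theorem exists_indSmooth_and_not_lurel_of_not_smoothToUniformizing (h : ¬ SmoothToUniformizing) :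
    ∃ p : ℕ, p.Prime ∧
      (∀ (k K : Type) [Field k] [CharP k p] [PerfectField k] [Field K] [Algebra k K],
        (⊤ : IntermediateField k K).FG → ∀ O : ValuationSubring K,
        (∀ c : k, algebraMap k K c ∈ O) → ∀ R : Subalgebra k K, R.FG →
        R.toSubring ≤ O.toSubring →
        ∃ (T : Type) (_ : CommRing T) (_ : Algebra k T), Algebra.Smooth k T ∧
          ∃ (ψ : R →ₐ[k] T) (χ : T →ₐ[k] K), (∀ t : T, χ t ∈ O) ∧ ∀ r : R, χ (ψ r) = (r : K)) ∧
      ¬ (∀ (k K : Type) [Field k] [CharP k p] [PerfectField k] [Field K] [Algebra k K],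
        (⊤ : IntermediateField k K).FG → ∀ O : ValuationSubring K,
        (∀ c : k, algebraMap k K c ∈ O) → ∀ R : Subalgebra k K, R.FG →
        R.toSubring ≤ O.toSubring →
        ∃ (A : Subalgebra k K) (h : A.toSubring ≤ O.toSubring), R ≤ A ∧ A.FG ∧
          IsFractionRing A K ∧ IsRegularLocalRing (Localization.AtPrime
            (Ideal.comap (Subring.inclusion h) (IsLocalRing.maximalIdeal O)))) ∧
      ¬ ResolutionInChar.{0} p := by
  by_contra hcon
  apply h
  intro p hp hind
  by_contra hlu
  apply hcon
  refine ⟨p, hp, hind, hlu, fun H => hlu ?_⟩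
  intro k K _ _ _ _ _
  exact lurel_of_resolutionInChar p hp H k K

end Summit.ResolutionOfSingularities.ResolutionOfSingularities.Theorems.SmoothToUniformizing.Negative
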